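import Summits.Ventures.PercRepro2.TypedCountCertificate

/-!
# Edge-monotonicity of the typed point-split count is false
(blind cell PercRepro2, night-3 g25, 2026-08-29; `proofs/NIGHT3-CERT.md` §34.11)

§33.3 recorded `T(H) ≥ T(H − e)` for every edge `e` (4,213 random instances, 0 violations; in the
tensor cone on every instance with `n = 4`) and recommended it as the inductive statement.  It is
**false at `n = 5`**: on `H` = edges `(0,2) (0,3) (0,4) (1,2) (1,4) (3,4)` (`s = 0`, `v = 1`) with
`f = [{0,3,4} ⊆ ·]`, `g = [2 ∈ ·]`, the typed count is `T(H) = 2` while deleting the edge `(0,2)`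
gives `T(H − e) = 3` (found by the tensor-cone census j324126 and the all-up-set check exh5.c;
exact Python re-check).  Both counts are nonnegative — only the monotonicity fails.
Own work; standard axioms.
-/

namespace Summit.Ventures.PercRepro2

namespace TypedCert

/-- `T(H) = 2` on the witness. -/
theorem Tform_monoWitness_eq_two :
    Tform [(0, 2), (0, 3), (0, 4), (1, 2), (1, 4), (3, 4)] 0 1
      (fun X : Nat => if X &&& 25 = 25 then (1 : ℚ) else 0)
      (fun X : Nat => if X.testBit 2 then (1 : ℚ) else 0) = 2 := by
  decide +kernel

/-- `T(H − e) = 3` on the witness, `e = (0, 2)`. -/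
theorem Tform_monoWitness_erase_eq_three :
    Tform [(0, 3), (0, 4), (1, 2), (1, 4), (3, 4)] 0 1
      (fun X : Nat => if X &&& 25 = 25 then (1 : ℚ) else 0)
      (fun X : Nat => if X.testBit 2 then (1 : ℚ) else 0) = 3 := by
  decide +kernel

/-- The indicator of «the set contains the mask `U`» is mask-monotone. -/
lemma monoMask_indicator_subset' {R : Type*} [Field R] [LinearOrder R] [IsStrictOrderedRing R]
    (U : Nat) : MonoMask (fun X : Nat => if X &&& U = U then (1 : R) else 0) := by
  intro X Y h
  simp only
  by_cases hX : X &&& U = U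
  · have hY : Y &&& U = U := by
      have h1 : X &&& Y = X := h
      calc Y &&& U = Y &&& (X &&& U) := by rw [hX]
        _ = (Y &&& X) &&& U := by rw [Nat.land_assoc]
        _ = (X &&& Y) &&& U := by rw [Nat.land_comm Y X]
        _ = X &&& U := by rw [h1]
        _ = U := hX
    simp [hX, hY]
  · simp only [hX, if_false]
    split_ifs <;> norm_num

/-- The indicator of «vertex `x` belongs to the set» is mask-monotone. -/
lemma monoMask_indicator' {R : Type*} [Field R] [LinearOrder R] [IsStrictOrderedRing R] (x : Nat) :
    MonoMask (fun X : Nat => if X.testBit x then (1 : R) else 0) := by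
  intro X Y h
  simp only
  by_cases hX : X.testBit x
  · have hY : Y.testBit x = true := by
      have := congrArg (fun Z => Z.testBit x) h
      simp only [Nat.testBit_land] at this
      rw [hX] at this
      simpa using this.symm
    simp [hX, hY]
  · simp only [hX, Bool.false_eq_true, if_false]
    split_ifs <;> norm_num

/-- **Edge-monotonicity fails**: there are mask-monotone `f, g` with `T(H) < T(H − e)`. -/
theorem exists_typedCount_lt_erase :
    ∃ f g : Nat → ℚ, MonoMask f ∧ MonoMask g ∧
      Tform [(0, 2), (0, 3), (0, 4), (1, 2), (1, 4), (3, 4)] 0 1 f g <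
        Tform [(0, 3), (0, 4), (1, 2), (1, 4), (3, 4)] 0 1 f g :=
  ⟨_, _, monoMask_indicator_subset' 25, monoMask_indicator' 2, by
    rw [Tform_monoWitness_eq_two, Tform_monoWitness_erase_eq_three]; norm_num⟩

end TypedCert

end Summit.Ventures.PercRepro2
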